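import Summits.KontsevichZagierPeriods.KontsevichZagierPeriods.Theorems.RootDecompQuadraticDescentPair18ReductionP5

/-! # `RootDecompQuadraticDescentPair18ReductionP6` — part 6/7 of the mechanical ≤400-line split of `Pair18Reduction_v5_landing.lean` (sha256 0a10c70876ba8bf2…)
Source: decomp-kz lens-6 g8 `Pair18Reduction.lean` v5 (HOME/decomp-kz-lens-6/g8/, sha256 9036e907…; critic g3 CLEARED 12:08:58Z/13:14:52Z): census pair #18 reduced to strips — `pair18_iff_strips : KZ.of A18.rep − 2 • KZ.of B18.rep ∈ KZ.relations ↔ [U1] − [U2r] + [SL] − 2•[K12c] + 2•[Kh] ∈ KZ.relations` (namespace …RootDecompQuadraticDescent.Pair18); `#print axioms` pins removed for landing.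
Split by census-1 g9 `gen/splitlean.py`: scopes re-opened with their `open`/`variable`/`set_option` context; mathematics and declaration order unchanged. -/

noncomputable section
open MeasureTheory Set MvPolynomial
namespace Summit.KontsevichZagierPeriods.RootDecompQuadraticDescent.Pair18
open Literature.NumberTheory.Transcendental
open Literature.NumberTheory.Transcendental.KZ
open Literature.ModelTheory.ExponentialFields (IsSemialgebraic continuous_aeval_real)
open Summit.KontsevichZagierPeriods.RootDecompQuadraticDescent.DarkPairs (rel_reflect_rep rel_double
  update_one_apply_zero one_div_eq_mul_one_div)
/-- Auxiliary step `last_one_eq` (§1): last one eq. [bookkeeping] -/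
private theorem last_one_eq : (Fin.last 1 : Fin 2) = 1 := rfl

/-- Auxiliary step `init2_zero` (§1): init2 zero. [bookkeeping] -/
@[simp] private theorem init2_zero (z : Fin 2 → ℝ) : Fin.init z 0 = z 0 := rfl

/-- Auxiliary step `rel_symm` (§2): rel symm. [bookkeeping] -/
private theorem rel_symm {a b : KZ.FormalRep} (h : a - b ∈ KZ.relations) : b - a ∈ KZ.relations := by
  have h' := neg_mem h
  rwa [neg_sub] at h'

/-- Auxiliary step `rel_trans` (§2): rel trans. [bookkeeping] -/
private theorem rel_trans {a b c : KZ.FormalRep} (h₁ : a - b ∈ KZ.relations) (h₂ : b - c ∈ KZ.relations) :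
    a - c ∈ KZ.relations := by
  have h := add_mem h₁ h₂
  rwa [sub_add_sub_cancel] at h

/-- **(box → band)** the affine fibre substitution `s = 1 + E(t)·σ` from the square onto the shifted
band `{1 ≤ s ≤ 1 + E(t)}`, for an edge `E` positive and differentiable on the OPEN base (it may vanish
at `t = 0, 1`): rule 2 over the open base (`KZ.of_sub_of_mem_relations_of_affine`) between two null
moves. -/
private theorem box_to_band (E : Edge) (hEpos : ∀ t ∈ Ioo (0 : ℝ) 1, 0 < E.f t)
    (hEd : DifferentiableOn ℝ E.f (Ioo 0 1)) (P : RFun 2) (R : KZ.IntegralRep 2)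
    (hR : R.domain = sbDom oneE E.onePlus)
    (hint : ∀ z ∈ cube 2, 0 < z 0 → z 0 < 1 →
      P.fn z = R.integrand (Fin.snoc (Fin.init z) (1 + E.f (z 0) * z 1)) * E.f (z 0)) :
    KZ.of P.rep - KZ.of R ∈ KZ.relations := by
  have hP : P.rep.domain = sbDom zeroE oneE := by rw [RFun.rep_domain, cube_eq_sbDom]
  have h1 := rel_open P.rep zeroE oneE hP
  have h3 := rel_open R oneE E.onePlus hR
  have h2 : KZ.of (OB P.rep zeroE oneE hP) - KZ.of (OB R oneE E.onePlus hR) ∈ KZ.relations := by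
    refine of_sub_of_mem_relations_of_affine isOpen_Gopen (α := fun _ => (1 : ℝ))
      (β := fun y => E.f (y 0)) (a := fun y => zeroE.f (y 0)) (b := fun y => oneE.f (y 0))
      (a' := fun y => oneE.f (y 0)) (b' := fun y => E.onePlus.f (y 0)) ?_
      (E.sa.mono Gopen_subset isSemialgebraic_Gopen) (differentiableOn_const _) ?_
      (fun y hy => hEpos _ ⟨hy.1, hy.2⟩) _ _ rfl rfl (fun y _ => by simp) (fun y _ => by simp)
      fun z hz => ?_
    · simpa using isSemialgebraicFunOn_ratCast isSemialgebraic_Gopen 1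
    · exact hEd.comp (fun y _ => (differentiableAt_apply (𝕜 := ℝ) 0 y).differentiableWithinAt)
        fun y hy => ⟨hy.1, hy.2⟩
    · have hz' : z ∈ obDom zeroE oneE := hz
      rw [mem_obDom] at hz'
      have hzc : z ∈ cube 2 := by
        rw [cube_eq_sbDom]; exact obDom_subset zeroE oneE hz
      rw [OB_integrand, OB_integrand, RFun.rep_integrand, last_one_eq]
      simpa only [init2_zero] using hint z hzc hz'.1.1 hz'.1.2
  exact rel_trans (rel_trans h1 h2) (rel_symm h3)

/-- Auxiliary step `abs_aeval_one_le` (§5): abs aeval one le. [bookkeeping] -/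
private theorem abs_aeval_one_le (z : Fin 2 → ℝ) : |aeval z (1 : MvPolynomial (Fin 2) ℚ)| ≤ 1 := by simp

/-- Auxiliary step `snoc2_zero` (§1): snoc2 zero. [bookkeeping] -/
@[simp] private theorem snoc2_zero (x : Fin 1 → ℝ) (t : ℝ) : (Fin.snoc x t : Fin 2 → ℝ) 0 = x 0 := rfl

/-- Auxiliary step `snoc2_one` (§1): snoc2 one. [bookkeeping] -/
@[simp] private theorem snoc2_one (x : Fin 1 → ℝ) (t : ℝ) : (Fin.snoc x t : Fin 2 → ℝ) 1 = t := rfl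

/-! ## §10 Row #18 REDUCED -/

/-- **Row #18 reduced to a triangle-pair / band statement** (rules 1 + 2, rational affine data):
`[A18] − 2·[B18] ∈ KZ.relations ↔ [Δ, 1/(2+wv)] + [Δ, 1/(2−wv)] − 2·S18h ∈ KZ.relations`. -/
theorem pair18_iff : KZ.of A18.rep - 2 • KZ.of B18.rep ∈ KZ.relations ↔
    KZ.of (TΔ' 1 (by norm_num)) + KZ.of (TΔ' (-1) (by norm_num)) - 2 • KZ.of S18h ∈ KZ.relations := by
  have hB : (2 : ℕ) • (KZ.of B18.rep - KZ.of S18h) ∈ KZ.relations := AddSubgroup.nsmul_mem _ b18_affine 2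
  have key : (KZ.of A18.rep - 2 • KZ.of B18.rep) -
      (KZ.of (TΔ' 1 (by norm_num)) + KZ.of (TΔ' (-1) (by norm_num)) - 2 • KZ.of S18h) ∈ KZ.relations := by
    have h := sub_mem a18_split hB
    convert h using 1
    simp only [smul_sub]
    abel
  constructor
  · intro h
    have h' := sub_mem h key
    convert h' using 1
    abel
  · intro h
    have h' := add_mem h key
    convert h' using 1
    abel

/-- **Doubled form through the c-trick**:
`2·([A18] − 2·[B18]) ∈ KZ.relations ↔ G(½) + G(−½) − 2·S18 ∈ KZ.relations`,
i.e. (values) `2·H(Π_L) = 2·H(S(½,1))` with `Π_L = {0 ≤ X ≤ 1, X + 3/2 ≤ Y ≤ X + 5/2}`. -/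
theorem pair18_iff_doubled : 2 • (KZ.of A18.rep - 2 • KZ.of B18.rep) ∈ KZ.relations ↔
    KZ.of (Gc (1 / 2) (by norm_num)).rep + KZ.of (Gc (-1 / 2) (by norm_num)).rep - 2 • KZ.of S18 ∈
      KZ.relations := by
  have hB : (4 : ℕ) • (KZ.of B18.rep - KZ.of S18h) ∈ KZ.relations := AddSubgroup.nsmul_mem _ b18_affine 4
  have hS : (2 : ℕ) • (KZ.of S18 - KZ.of S18h - KZ.of S18h) ∈ KZ.relations :=
    AddSubgroup.nsmul_mem _ two_s18h 2
  have key : 2 • (KZ.of A18.rep - 2 • KZ.of B18.rep) -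
      (KZ.of (Gc (1 / 2) (by norm_num)).rep + KZ.of (Gc (-1 / 2) (by norm_num)).rep - 2 • KZ.of S18) ∈
      KZ.relations := by
    have h := add_mem (sub_mem two_a18_G hB) hS
    convert h using 1
    simp only [smul_sub]
    abel
  constructor
  · intro h
    have h' := sub_mem h key
    convert h' using 1
    abel
  · intro h
    have h' := add_mem h key
    convert h' using 1
    abel

/-- One direction without the factor: the band statement DECIDES row #18. -/
theorem pair18_of_bands
    (h : KZ.of (TΔ' 1 (by norm_num)) + KZ.of (TΔ' (-1) (by norm_num)) - 2 • KZ.of S18h ∈ KZ.relations) :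
    KZ.of A18.rep - 2 • KZ.of B18.rep ∈ KZ.relations :=
  pair18_iff.2 h

/-! ## A-attachment in box form (NODE addendum 8l (A), gen 8 close)

The triangle reps `TΔ′(c) = [{0 ≤ v ≤ 1 − w}, 1/(2 + cwv)]` of the A-side normal form are congruent to
BOX reps by the fibre blow-down `v = (1 − w)σ` (one `rel_shift` + one `box_to_band`):
`[TΔ′(c)] ≡ [SLc(c)] := [□², (1 − w)/(2 + c w(1−w)σ)]`.  For `c = −1` this is the strip `[SL]` of
`TelescopeCube.Strips` (`L_strip : [Λ(1/2)] ≡ [SL]`), i.e. `[TΔ′(−1)] ≡ [Λ(1/2)]`; for `c = 1` it is the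
elementary strip with value `log²2/2`.  Hence (with `a18_box` below)
`[A18] ≡ [SLc 1] + [SLc (−1)]`, and census row #18 reads entirely over box reps of rational functions
with parameter-linear denominators. -/

/-- Auxiliary definition `PDs` (§10): PDs. [bookkeeping] -/
def PDs (c : ℚ) : MvPolynomial (Fin 2) ℚ := 2 + C c * X 0 * (X 1 - 1)

/-- Auxiliary step `PDs_ge` (§10): PDs ge. [bookkeeping] -/
theorem PDs_ge {c : ℚ} (hc : -1 ≤ c ∧ c ≤ 1) {z : Fin 2 → ℝ} (hz : z ∈ sbDom oneE omE.onePlus) :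
    (7 / 4 : ℝ) ≤ aeval z (PDs c) := by
  have h := PΔs_ge hc hz
  simp only [PΔs, map_add, map_mul, map_sub, map_one, aeval_C, aeval_X, eq_ratCast] at h
  simp only [PDs, map_add, map_mul, map_sub, map_ofNat, map_one, aeval_C, aeval_X, eq_ratCast]
  linarith

/-- `TΔ′(c)` shifted to the band `{1 ≤ v ≤ 2 − w}`. -/
def TΔ's (c : ℚ) (hc : -1 ≤ c ∧ c ≤ 1) : KZ.IntegralRep 2 :=
  BRq oneE omE.onePlus 1 (PDs c) (7 / 4) 1 (by norm_num) (fun _ hz => PDs_ge hc hz)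
    fun z _ => abs_aeval_one_le z

/-- Denominator of the box form: `2 + c w (1 − w) σ`. -/
def QSL (c : ℚ) : MvPolynomial (Fin 2) ℚ := 2 + C c * X 0 * (1 - X 0) * X 1

/-- Auxiliary step `QSL_pos` (§10): QSL pos. [bookkeeping] -/
theorem QSL_pos {c : ℚ} (hc : -1 ≤ c ∧ c ≤ 1) {x : Fin 2 → ℝ} (hx : x ∈ cube 2) : 0 < aeval x (QSL c) := by
  have h0 := (hx 0).1; have h0' := (hx 0).2; have h1 := (hx 1).1; have h1' := (hx 1).2
  simp only [QSL, map_add, map_mul, map_sub, map_ofNat, map_one, aeval_C, aeval_X, eq_ratCast]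
  have hm : 0 ≤ x 0 * (1 - x 0) * x 1 := mul_nonneg (mul_nonneg h0 (by linarith)) h1
  have hM : x 0 * (1 - x 0) * x 1 ≤ 1 / 4 := by
    have : x 0 * (1 - x 0) * x 1 ≤ x 0 * (1 - x 0) * 1 :=
      mul_le_mul_of_nonneg_left h1' (mul_nonneg h0 (by linarith))
    nlinarith [sq_nonneg (x 0 - 1 / 2)]
  have := cmul_ge_neg hc hm
  nlinarith

/-- The box form `SLc(c) = [□², (1 − w)/(2 + c w(1−w)σ)]`. -/
def SLc (c : ℚ) (hc : -1 ≤ c ∧ c ≤ 1) : RFun 2 := ⟨1 - X 0, QSL c, fun _ hx => (QSL_pos hc hx).ne'⟩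

/-- (s1) fibre translation `TΔ′ ≡ TΔ′s`. -/
theorem s1 (c : ℚ) (hc : -1 ≤ c ∧ c ≤ 1) : KZ.of (TΔ' c hc) - KZ.of (TΔ's c hc) ∈ KZ.relations := by
  refine rel_shift omE (TΔ' c hc) (TΔ's c hc) rfl rfl fun z _ => ?_
  simp only [TΔ', TΔ's, BRq_integrand, PD, PDs, map_add, map_mul, map_sub, map_ofNat, map_one, aeval_C,
    aeval_X, eq_ratCast, snoc2_zero, snoc2_one, init2_zero, add_sub_cancel_left]

/-- (s2) fibre blow-down `v = 1 + (1 − w)σ`: `SLc ≡ TΔ′s`. -/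
theorem s2 (c : ℚ) (hc : -1 ≤ c ∧ c ≤ 1) : KZ.of (SLc c hc).rep - KZ.of (TΔ's c hc) ∈ KZ.relations := by
  refine box_to_band omE (fun t ht => by simp only [omE_f]; linarith [ht.2])
    (fun t _ => ?_) (SLc c hc) (TΔ's c hc) rfl fun z hz _ _ => ?_
  · apply DifferentiableAt.differentiableWithinAt
    show DifferentiableAt ℝ (fun t : ℝ => 1 - t) t
    fun_prop
  · have hQ := QSL_pos hc hz
    simp only [QSL, map_add, map_mul, map_sub, map_ofNat, map_one, aeval_C, aeval_X, eq_ratCast] at hQ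
    simp only [RFun.fn, SLc, TΔ's, QSL, PDs, BRq_integrand, map_add, map_mul, map_sub, map_ofNat, map_one,
      aeval_C, aeval_X, eq_ratCast, snoc2_zero, snoc2_one, init2_zero, omE_f, add_sub_cancel_left]
    have hQ0 : (2 : ℝ) + (c : ℝ) * z 0 * (1 - z 0) * z 1 ≠ 0 := hQ.ne'
    have hQ' : (2 : ℝ) + (c : ℝ) * z 0 * ((1 - z 0) * z 1) ≠ 0 := by
      intro h'; apply hQ0; linarith [h']
    field_simp
    try ring

/-- **`[TΔ′(c)] ≡ [SLc(c)]`** (box form of the A-side pieces). -/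
theorem tΔ'_box (c : ℚ) (hc : -1 ≤ c ∧ c ≤ 1) : KZ.of (TΔ' c hc) - KZ.of (SLc c hc).rep ∈ KZ.relations :=
  rel_trans (s1 c hc) (rel_symm (s2 c hc))

/-- **A-side over boxes**: `[A18] ≡ [SLc 1] + [SLc (−1)] = [□², (1−w)/(2 + w(1−w)σ)] + [□², (1−w)/(2 − w(1−w)σ)]`. -/
theorem a18_box : KZ.of A18.rep - KZ.of (SLc 1 (by norm_num)).rep - KZ.of (SLc (-1) (by norm_num)).rep ∈
    KZ.relations := by
  have h := a18_split
  have h1 := tΔ'_box 1 (by norm_num)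
  have h2 := tΔ'_box (-1) (by norm_num)
  convert add_mem (add_mem h h1) h2 using 1
  abel

/-- `SL` exactly as in `TelescopeCube.Strips` (`[Λ(1/2)] ≡ [SL]` there): `[□², (1/2)(1−v)/(1 − P′v/2 + P′v²/2)]`. -/
def SLDen : MvPolynomial (Fin 2) ℚ := C 1 - C (1 / 2) * X 1 * X 0 + C (1 / 2) * X 1 * (X 0 * X 0)

/-- Auxiliary step `SLDen_pos` (§10): SLDen pos. [bookkeeping] -/
theorem SLDen_pos {x : Fin 2 → ℝ} (hx : x ∈ cube 2) : 0 < aeval x SLDen := by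
  have h0 := (hx 0).1; have h0' := (hx 0).2; have h1 := (hx 1).1; have h1' := (hx 1).2
  simp only [SLDen, map_add, map_sub, map_mul, map_one, aeval_C, aeval_X, eq_ratCast]
  push_cast
  nlinarith [sq_nonneg (x 0 - 1 / 2), mul_nonneg (sub_nonneg.2 h1') (mul_nonneg h0 (sub_nonneg.2 h0')),
    mul_nonneg h1 (sq_nonneg (x 0 - 1 / 2))]

/-- Auxiliary definition `SL` (§10): SL. [bookkeeping] -/
def SL : RFun 2 := ⟨C (1 / 2) * (C 1 - X 0), SLDen, fun _ hx => (SLDen_pos hx).ne'⟩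

/-- `[SLc (−1)] ≡ [SL]` (same function, rescaled fraction). -/
theorem sLc_neg_one_SL : KZ.of (SLc (-1) (by norm_num)).rep - KZ.of SL.rep ∈ KZ.relations :=
  RFun.rel_of_eqOn fun x hx => by
    have hQ := QSL_pos (c := -1) (by norm_num) hx
    have hD := SLDen_pos hx
    simp only [QSL, map_add, map_mul, map_sub, map_ofNat, map_one, aeval_C, aeval_X, eq_ratCast] at hQ
    simp only [SLDen, map_add, map_sub, map_mul, map_one, aeval_C, aeval_X, eq_ratCast] at hD
    simp only [RFun.fn, SLc, SL, QSL, SLDen, map_add, map_mul, map_sub, map_ofNat, map_one, aeval_C, aeval_X,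
      eq_ratCast]
    push_cast at hQ hD ⊢
    rw [div_eq_div_iff hQ.ne' hD.ne']
    ring

/-- **`[TΔ′(−1)] ≡ [SL]`**, the A-attachment of NODE addendum 8l (A) (so `[TΔ′(−1)] ≡ [Λ(1/2)]` via `Strips.L_strip`). -/
theorem tΔ'_neg_one_SL : KZ.of (TΔ' (-1) (by norm_num)) - KZ.of SL.rep ∈ KZ.relations :=
  rel_trans (tΔ'_box (-1) (by norm_num)) sLc_neg_one_SL

/-! ## The `c = 1` box `[SLc 1]` split into the two classical strips (NODE addendum 8m.2)

`[SLc 1] ≡ [U1] − [U2r]` with `U1 = [□², 1/(1 + wσ)]` (`= π²/12`) and `U2r = [□², 1/(2 − w + wσ)]`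
(`= Li₂(½)`): cut `U1` along the edge `σ = (1 − w)/2` (`br_cut`); its lower band is `[SLc 1]` (fibre
blow-down `σ = (1 − w)σ′/2`: `rel_shift` + `box_to_band`); its upper band is `[U2r]` (increasing affine
fibre map `σ = (1 − w)/2 + (1 + w)τ/2`, `of_sub_of_mem_relations_of_fibreMap`).  With `a18_box` and
`sLc_neg_one_SL`: **`[A18] ≡ [U1] − [U2r] + [SL]`** (`a18_strips`). -/

/-- The edge `(1 − t)/2`. -/
def hoE : Edge := mkEdge (fun t => (1 - t) / 2) (1 - X 0) 2
  (fun y _ => by simp only [map_ofNat]; norm_num)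
  (fun y _ => by simp only [map_sub, map_one, aeval_X, map_ofNat])
  (fun t ht => by have := ht.2; exact div_nonneg (by linarith) (by norm_num))
  (by fun_prop)

/-- Auxiliary step `hoE_f` (§10): ho E f. [bookkeeping] -/
@[simp] theorem hoE_f (t : ℝ) : hoE.f t = (1 - t) / 2 := rfl

/-- Auxiliary definition `QU1` (§10): QU1. [bookkeeping] -/
def QU1 : MvPolynomial (Fin 2) ℚ := 1 + X 0 * X 1

/-- Auxiliary step `QU1_pos` (§10): QU1 pos. [bookkeeping] -/
theorem QU1_pos {x : Fin 2 → ℝ} (hx : x ∈ cube 2) : 0 < aeval x QU1 := by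
  have h0 := (hx 0).1; have h1 := (hx 1).1
  simp only [QU1, map_add, map_mul, map_one, aeval_X]
  nlinarith [mul_nonneg h0 h1]

/-- `U1 = [□², 1/(1 + wσ)]` (value `π²/12`). -/
def U1 : RFun 2 := ⟨1, QU1, fun _ hx => (QU1_pos hx).ne'⟩

/-- Auxiliary definition `QU2` (§10): QU2. [bookkeeping] -/
def QU2 : MvPolynomial (Fin 2) ℚ := 2 - X 0 + X 0 * X 1

/-- Auxiliary step `QU2_pos` (§10): QU2 pos. [bookkeeping] -/
theorem QU2_pos {x : Fin 2 → ℝ} (hx : x ∈ cube 2) : 0 < aeval x QU2 := by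
  have h0 := (hx 0).1; have h0' := (hx 0).2; have h1 := (hx 1).1
  simp only [QU2, map_add, map_sub, map_mul, map_ofNat, aeval_X]
  nlinarith [mul_nonneg h0 h1]

/-- `U2r = [□², 1/(2 − w + wσ)]` (value `Li₂(½)`; the reflection `σ ↦ 1 − σ` of `[□², (1/2)/(1 − wσ/2)]`). -/
def U2r : RFun 2 := ⟨1, QU2, fun _ hx => (QU2_pos hx).ne'⟩

/-- Auxiliary step `hU1` (§10): h U1. [bookkeeping] -/
theorem hU1 : U1.rep.domain = sbDom zeroE oneE := by rw [RFun.rep_domain, cube_eq_sbDom]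

/-- Auxiliary step `hoE_le_one` (§10): ho E le one. [bookkeeping] -/
theorem hoE_le_one : ∀ t ∈ Icc (0 : ℝ) 1, hoE.f t ≤ oneE.f t := fun t ht => by
  simp only [hoE_f, oneE_f]; linarith [ht.1]

/-- Auxiliary step `zero_le_hoE` (§10): zero le ho E. [bookkeeping] -/
theorem zero_le_hoE : ∀ t ∈ Icc (0 : ℝ) 1, zeroE.f t ≤ hoE.f t := fun t ht => by
  simp only [hoE_f, zeroE_f]; linarith [ht.2]

/-- The two pieces of `U1` cut along `σ = (1 − w)/2`. -/
def U1lo : KZ.IntegralRep 2 := loP U1.rep zeroE hoE oneE hU1 hoE_le_one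
/-- Auxiliary definition `U1hi` (§10): U1hi. [bookkeeping] -/
def U1hi : KZ.IntegralRep 2 := hiP U1.rep zeroE hoE oneE hU1 zero_le_hoE

/-- (u1) band cut (rule 1a). -/
theorem u1_cut : KZ.of U1.rep - KZ.of U1lo - KZ.of U1hi ∈ KZ.relations :=
  br_cut U1.rep zeroE hoE oneE hU1 zero_le_hoE hoE_le_one

/-- Auxiliary definition `QU1s` (§10): QU1s. [bookkeeping] -/
def QU1s : MvPolynomial (Fin 2) ℚ := 1 + X 0 * (X 1 - 1)

/-- Auxiliary step `QU1s_ge` (§10): QU1s ge. [bookkeeping] -/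
theorem QU1s_ge {z : Fin 2 → ℝ} (hz : z ∈ sbDom oneE hoE.onePlus) : (1 : ℝ) ≤ aeval z QU1s := by
  obtain ⟨⟨h0, _⟩, h1, _⟩ := mem_sbDom.1 hz
  simp only [oneE_f] at h1
  simp only [QU1s, map_add, map_mul, map_sub, map_one, aeval_X]
  nlinarith [mul_nonneg h0 (by linarith : (0 : ℝ) ≤ z 1 - 1)]

/-- `U1lo` shifted to `{1 ≤ σ ≤ 1 + (1 − w)/2}`: integrand `1/(1 + w(σ − 1))`. -/
def U1s : KZ.IntegralRep 2 :=
  BRq oneE hoE.onePlus 1 QU1s 1 1 one_pos (fun _ hz => QU1s_ge hz) fun z _ => abs_aeval_one_le z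

/-- (u2) fibre translation `U1lo ≡ U1s`. -/
theorem u1lo_shift : KZ.of U1lo - KZ.of U1s ∈ KZ.relations := by
  refine rel_shift hoE U1lo U1s rfl rfl fun z _ => ?_
  simp only [U1lo, U1s, loP_integrand, RFun.rep_integrand, RFun.fn, U1, QU1, QU1s, BRq_integrand, map_add,
    map_mul, map_sub, map_one, aeval_X, snoc2_zero, snoc2_one, init2_zero, add_sub_cancel_left]

/-- (u3) fibre blow-down `σ = 1 + (1 − w)σ′/2`: `SLc 1 ≡ U1s`. -/
theorem sLc_one_shift : KZ.of (SLc 1 (by norm_num)).rep - KZ.of U1s ∈ KZ.relations := by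
  refine box_to_band hoE (fun t ht => by simp only [hoE_f]; linarith [ht.2])
    (fun t _ => ?_) (SLc 1 (by norm_num)) U1s rfl fun z hz _ _ => ?_
  · apply DifferentiableAt.differentiableWithinAt
    show DifferentiableAt ℝ (fun t : ℝ => (1 - t) / 2) t
    fun_prop
  · have hQ := QSL_pos (c := 1) (by norm_num) hz
    simp only [QSL, map_add, map_mul, map_sub, map_ofNat, map_one, aeval_X, one_mul] at hQ
    simp only [RFun.fn, SLc, U1s, QSL, QU1s, BRq_integrand, map_add, map_mul, map_sub, map_ofNat, map_one,
      aeval_X, one_mul, snoc2_zero, snoc2_one, init2_zero, hoE_f, add_sub_cancel_left]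
    have hQ0 : (2 : ℝ) + z 0 * (1 - z 0) * z 1 ≠ 0 := hQ.ne'
    rw [show (1 : ℝ) + z 0 * ((1 - z 0) / 2 * z 1) = (2 + z 0 * (1 - z 0) * z 1) / 2 by ring]
    field_simp
    try ring

end Summit.KontsevichZagierPeriods.RootDecompQuadraticDescent.Pair18
end
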